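import Summits.BirchSwinnertonDyer.Rank1Residual.Additive.SignedTwistMinusCorankBound
import HarnessLib

/-!
# Transversality of the minus Kummer classes to the Kummer image of `W(ℚ_p)` in `H¹(ℚ_p, W[p^m])`
# — B3's transversality half in the cocycle currency of files 82/91 (cell `b2b-bsdres`,
# CLASS-CLOSURE lane, class O10 — x1b GEN 40, class lead; file 93 of the series)

HONEST FRAMING (cell `b2b-bsdres`, run/shared/lean/b2b/bsd-rank1-residual/, verbatim in every
file): the goal of the cell is to DELETE the COMBINATION-SHAPED residual classes of the
Birch–Swinnerton-Dyer formula for ALL analytic-rank `≤ 1` elliptic curves over `ℚ` — "full BSD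
formula for every rank `≤ 1` curve in class `C`" assembled STRICTLY from published theorems — so
that the rank-`≤ 1` remainder becomes exactly the CONSTRUCTION-SHAPED classes, which are TYPED
(missing-input `Prop`s), NOT attempted. This is not "finishing BSD". CLASS-CLOSURE lane: prove
what is provable now; shrink each hard class to its core with data; no claim beyond stated classes;
research routes on CONSTRUCTION-SHAPED X12 / O10; census / instrument output = EVIDENCE / conjecture
items, NEVER a Literature fact; `RESIDUAL-MAP.md` marks change only by signed lines. THIS FILE:
TOOL THEOREMS ONLY — no definition, no named Literature fact, no `sorry`, axioms standard; nothing
is booked; no label / mark / count / sub-cell moves; (C1_η), (C2_η-GZ), (C3_η) stay typed as filed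
(cc-typer-6's pen); nothing about `BSD(W, p)` of any pair is claimed.

## What (binders of file 91: the dictionary `Ψ : W(ℚ̄_p) ≃ V(ℚ̄_p)` at `E = ℚ_p`, `ι = closureEmb ℚ_p`,
## `V = C • W^{(c)}` with a good supersingular `a_p = 0` model, `K₀ ∋ θ = √c`, `η`, `κ`, generic
## tower hypotheses; `W_j = W(ℚ_j·ℚ_p)`, `N_n = E⁻_W(ℚ_n·ℚ_p) ∩ ker Tr_{n/0}`)

Brick B3 in level-`m` shape (x1b GEN 39 file 83, `TransverseLine.sup_eq_top_and_card_eq`) needs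
two inputs about the level-`m` minus condition `Σ_m ≤ H¹(ℚ_p, W[p^m])`: `#Σ_m ≥ p^m` (files 91/92,
x1b GEN 40) and TRANSVERSALITY `Σ_m ∩ 𝓚 = 0` to the Kummer image `𝓚` of `W(ℚ_p)`. The latter was
kernel at the POINT level on the `V`-side since GEN 31/32/34 (`exists_eq_nsmul_of_pow_nsmul_eq_add_
tower_padic`: an η-odd bottom point `P` with `p^j P ∈ E⁻(K_{n,v}) + p^{j+1} E(K_{n,v})` is
`p`-divisible); this file proves it in the COCYCLE currency of files 82/91:

* §1 `exists_eq_pow_smul_of_eq_zeroClause_sub_pow_smul`: if `Q ∈ W(ℚ_p)` and `Q = x − p^m • D` with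
  `x ∈ N_n`, `D ∈ W_n`, then `Q ∈ p^m • W(ℚ_p)` (induction on `m`: the point-level (T) through `Ψ`,
  η-oddness of `p⁻¹ΨQ` by Prop. 8.7, and the `p`-saturation of `N_n`, Lemma 8.17 / file 81).
* §2 **`eq_zero_of_minus_of_kummer`**: a class `ξ ∈ H¹(ℚ_p, W[p^m])` which (a) restricts on
  `Gal(ℚ̄_p/ℚ_n·ℚ_p)` to the Kummer cocycle `u ↦ uR − R` of a `p^m`-th root `R` of a point of
  `N_n` AND (b) is the Kummer class of a point `Q ∈ W(ℚ_p)` (`u ↦ uR′ − R′` on all of `Γ_{ℚ_p}`,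
  `p^m R′ = Q`) is ZERO: comparing the two cocycles gives `R − R′ − T ∈ W_n` for a torsion point `T`,
  so `Q = x − p^m D`; by §1 `Q = p^m Q_m` with `Q_m ∈ W(ℚ_p)`, and then `u ↦ uR′ − R′` is the
  coboundary of the torsion point `R′ − Q_m`.
* §3 `…_cyclotomic`: Kobayashi's setting (`F = ℚ(μ_p)`, `θ = √p*`, `κ` cyclotomic), all tower
  hypotheses discharged as in file 91.

So, for ANY receptacle `Σ_m` whose classes satisfy (a): `Σ_m ∩ 𝓚_{ℚ_p} = 0` where `𝓚_{ℚ_p}` is the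
set of classes satisfying (b). NOT here: the identification of (b) with the tree's
`kummerSelmerStructure` local condition at the `adicCompletion` model (file 76's transport), the
bound `#H¹(ℚ_p, W[p]) ≤ p²`, the receptacle packaging, (C1_η), (C2_η-GZ), (C3_η), any `BSD(W, p)`.

References: [Kobayashi2003] S. Kobayashi, Invent. Math. 152 (2003), §2 p. 4, Thm. 6.2 (p. 11),
Prop. 8.7 (p. 16), Prop. 8.12 ii) (pp. 17–18), Lemma 8.17 (p. 19); [GreenbergLNM1716] §3 p. 86.
-/

noncomputable section

open scoped Classical

open WeierstrassCurve Field

namespace Summit.BirchSwinnertonDyer.Rank1Residual.Additive.SignedTwist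

open Literature.NumberTheory.EllipticCurves Literature.NumberTheory.GaloisRepresentations
  Literature.NumberTheory.EllipticCurves.Kobayashi2003 Literature.NumberTheory.EllipticCurves.ZpDescent
  Summit.BirchSwinnertonDyer.Rank1Residual.AdditivePotMult
  Summit.BirchSwinnertonDyer.Rank1Residual.Additive.PadicCyclotomicTower
  Summit.BirchSwinnertonDyer.Rank1Residual.Additive.StrictSignedCount
  ZpExtension
open scoped ContRepresentation

section Generic

variable (W : WeierstrassCurve ℚ) [W.IsElliptic] (K₀ : Type) [Field K₀] [NumberField K₀] {θ : K₀} {c : ℚ}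
  (hθ : θ ∉ Set.range (algebraMap ℚ K₀)) (hc : θ ^ 2 = algebraMap ℚ K₀ c)
  {p : ℕ} [hp : Fact p.Prime] (κ : ZpExtension ℚ p)
  {V : WeierstrassCurve ℚ} [V.IsElliptic] {C : VariableChange ℚ} (hCV : C • W.quadraticTwist c = V)
  (η : absoluteGaloisGroup ℚ →* ℤˣ)
  (hη : ∀ σ : absoluteGaloisGroup ℚ, η σ = 1 ↔ σ • rootInClosure K₀ θ = rootInClosure K₀ θ)

/-! ## §1 `W(ℚ_p) ∩ (N_n + p^m W_n) ⊆ p^m W(ℚ_p)` -/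

omit [W.IsElliptic] in
include hθ hc hCV hη in
/-- **One step**: `Q ∈ W(ℚ_p)` with `Q = x − p • D`, `x ∈ N_n`, `D ∈ W_n` is `p • Q₁` with
`Q₁ ∈ W(ℚ_p)` — the point-level transversality (T) (Prop. 8.12 ii) + Lemma 8.17, kernel GEN 32/34)
read through `Ψ`: `ΨQ` is an η-odd bottom point with `ΨQ = Ψx + p • Ψ(−D)`, `Ψx ∈ E⁻_V(K_{n,v})`
((D4b1)), so `ΨQ = p • S`; `S` is η-eigen because `E(K_{0,v})` has no `p`-torsion.
[cite: Kobayashi2003, Prop. 8.12 ii) (pp. 17–18), Lemma 8.17 (p. 19), Prop. 8.7 (p. 16)] -/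
theorem exists_eq_smul_of_eq_zeroClause_sub_smul
    (hD : ∀ g : absoluteGaloisGroup ℚ, ∃ τ : absoluteGaloisGroup ℚ_[p],
      (resGalOfEmb (closureEmb (K := ℚ) ℚ_[p]) τ)⁻¹ * g ∈ towerTopSubgroup κ K₀)
    (hκ₀ : ∀ x, ∃ g ∈ galRange (K := ℚ) K₀, κ g = x) [(galRange (K := ℚ) K₀).Normal]
    (hidx : (galRange (K := ℚ) K₀).index ≤ p - 1) (hp2 : p ≠ 2)
    (M : WeierstrassCurve ℤ_[p]) [hE : (M.map PadicInt.Coe.ringHom).IsElliptic]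
    [hEt : (M.map PadicInt.toZMod).IsElliptic]
    (htr : Literature.NumberTheory.EllipticCurves.HasseManin.tr (M.map PadicInt.toZMod) = 0)
    (hVM : M.baseChange (AlgebraicClosure ℚ_[p]) = V.baseChange (AlgebraicClosure ℚ_[p]))
    (hU : ∀ n, localSubgroupOfEmb (towerSubgroup κ K₀ n) (closureEmb (K := ℚ) ℚ_[p]) = stab p (n + 1))
    {n : ℕ} {Q x D : localPoints W ℚ_[p]}
    (hQ : Q ∈ localLayerPointsOfEmb κ (closureEmb (K := ℚ) ℚ_[p]) W 0)
    (hx : x ∈ signedLocalPointsOfEmb κ (closureEmb (K := ℚ) ℚ_[p]) W (-1) n ⊓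
      (localTraceOfEmb κ (closureEmb (K := ℚ) ℚ_[p]) W 0 n).ker)
    (hDn : D ∈ localLayerPointsOfEmb κ (closureEmb (K := ℚ) ℚ_[p]) W n) (hQxD : Q = x - p • D) :
    ∃ Q₁ ∈ localLayerPointsOfEmb κ (closureEmb (K := ℚ) ℚ_[p]) W 0, Q = p • Q₁ := by
  set ι := closureEmb (K := ℚ) ℚ_[p] with hι
  set Ψ := localTransport W K₀ hθ hc hCV ℚ_[p] ι with hΨ
  have hidx0 : (galRange (K := ℚ) K₀).index ≠ 0 := Subgroup.FiniteIndex.index_ne_zero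
  have hsum := localFixedPointsOfEmb_le_sup_towerSigned_of_stab (ι := ι) (W := V)
    (U := towerSubgroup κ K₀) (M := M) hp2 htr (towerSubgroup_antitone κ K₀) hU hVM n
  -- `ΨQ` is an η-odd bottom point
  obtain ⟨hΨQ, hΨQη⟩ := localTransport_mem_localFixedPoints_and_eigen W K₀ hθ hc κ hCV ι η hη hQ
  obtain ⟨τ, -, hτ⟩ := exists_mem_localSubgroupOfEmb_ker_eta_eq_neg_one κ K₀ ι hθ hc η hη hD hκ₀
  have hτQ : τ • Ψ Q = -Ψ Q := by
    rw [hΨQη τ (by rw [localLayerSubgroupOfEmb_zero]; exact Subgroup.mem_top τ), hτ, Units.val_neg,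
      Units.val_one, neg_one_zsmul]
  -- `Ψx ∈ E⁻_V(K_{n,v})`, `Ψ(−D) ∈ E(K_{n,v})`
  obtain ⟨hxs, hxk⟩ := AddSubgroup.mem_inf.mp hx
  have hΨx : Ψ x ∈ towerSignedLocalPointsOfEmb (towerSubgroup κ K₀) ι V (-1) n :=
    localTransport_mem_towerSigned W K₀ hθ hc κ hCV ι hD hκ₀ hxs ((AddMonoidHom.mem_ker).mp hxk)
  have hΨD : Ψ (-D) ∈ localFixedPointsOfEmb ι V (towerSubgroup κ K₀ n) :=
    (localTransport_mem_localFixedPoints_and_eigen W K₀ hθ hc κ hCV ι η hη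
      ((localLayerPointsOfEmb κ ι W n).neg_mem hDn)).1
  have hPMQ : p ^ 0 • Ψ Q = Ψ x + p ^ (0 + 1) • Ψ (-D) := by
    rw [pow_zero, one_smul, zero_add, pow_one, hQxD, map_sub, map_neg, smul_neg, map_nsmul,
      sub_eq_add_neg]
  obtain ⟨S, hS, hQS⟩ := exists_eq_nsmul_of_pow_nsmul_eq_add_tower_padic κ K₀ ι V hp2 M
    (isUnit_Δ_of_isElliptic_toZMod p M) (hasseCoeff_mem_maximalIdeal_of_tr_eq_zero hp2 M htr) hVM hidx0
    (lt_half_sq_sub_one_of_le_sub_one hp2 hidx) n hsum hΨQ hτQ 0 hΨx hΨD hPMQ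
  -- `S` is η-eigen: `p • (σS − η(σ)S) = 0` and `E(K_{0,v})` has no `p`-torsion
  have hSη : ∀ σ ∈ localLayerSubgroupOfEmb κ ι 0,
      σ • S = ((η (resGalOfEmb ι σ) : ℤˣ) : ℤ) • S := by
    intro σ hσ
    have h0 := eq_zero_of_prime_pow_smul_eq_zero_localFixedPointsOfEmb_of_stab ι V (towerSubgroup κ K₀)
      hp2 M (isUnit_Δ_of_isElliptic_toZMod p M) (hasseCoeff_mem_maximalIdeal_of_tr_eq_zero hp2 M htr)
      hVM hU 0 1 (σ • S - ((η (resGalOfEmb ι σ) : ℤˣ) : ℤ) • S)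
      ((localFixedPointsOfEmb ι V _).sub_mem (smul_mem_localFixedPointsOfEmb ι V σ hS)
        ((localFixedPointsOfEmb ι V _).zsmul_mem hS _)) ?_
    · exact sub_eq_zero.mp h0
    · rw [pow_one, smul_sub, smul_comm, ← hQS, smul_comm p, ← hQS, hΨQη σ hσ, sub_self]
  refine ⟨Ψ.symm S, localTransport_symm_mem_localLayerPointsOfEmb W K₀ hθ hc κ hCV ι η hη hSη, ?_⟩
  apply Ψ.injective
  rw [map_nsmul, AddEquiv.apply_symm_apply, hQS]

omit [W.IsElliptic] in
include hθ hc hCV hη in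
/-- **`W(ℚ_p) ∩ (N_n + p^m•W_n) ⊆ p^m•W(ℚ_p)`**: by induction on `m` from the one-step lemma and
the `p`-saturation of the zero-clause group `N_n` in `W_n` (file 81
`mem_zeroClause_of_pow_smul_mem`). [cite: Kobayashi2003, Prop. 8.12 ii) (pp. 17–18), Lemma 8.17 (p. 19)] -/
theorem exists_eq_pow_smul_of_eq_zeroClause_sub_pow_smul
    (hD : ∀ g : absoluteGaloisGroup ℚ, ∃ τ : absoluteGaloisGroup ℚ_[p],
      (resGalOfEmb (closureEmb (K := ℚ) ℚ_[p]) τ)⁻¹ * g ∈ towerTopSubgroup κ K₀)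
    (hκ₀ : ∀ x, ∃ g ∈ galRange (K := ℚ) K₀, κ g = x) [(galRange (K := ℚ) K₀).Normal]
    (hidx : (galRange (K := ℚ) K₀).index ≤ p - 1) (hp2 : p ≠ 2)
    (M : WeierstrassCurve ℤ_[p]) [hE : (M.map PadicInt.Coe.ringHom).IsElliptic]
    [hEt : (M.map PadicInt.toZMod).IsElliptic]
    (htr : Literature.NumberTheory.EllipticCurves.HasseManin.tr (M.map PadicInt.toZMod) = 0)
    (hVM : M.baseChange (AlgebraicClosure ℚ_[p]) = V.baseChange (AlgebraicClosure ℚ_[p]))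
    (hU : ∀ n, localSubgroupOfEmb (towerSubgroup κ K₀ n) (closureEmb (K := ℚ) ℚ_[p]) = stab p (n + 1))
    {n : ℕ} (m : ℕ) : ∀ {Q x D : localPoints W ℚ_[p]},
      Q ∈ localLayerPointsOfEmb κ (closureEmb (K := ℚ) ℚ_[p]) W 0 →
      x ∈ signedLocalPointsOfEmb κ (closureEmb (K := ℚ) ℚ_[p]) W (-1) n ⊓
        (localTraceOfEmb κ (closureEmb (K := ℚ) ℚ_[p]) W 0 n).ker →
      D ∈ localLayerPointsOfEmb κ (closureEmb (K := ℚ) ℚ_[p]) W n → Q = x - p ^ m • D →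
      ∃ Q' ∈ localLayerPointsOfEmb κ (closureEmb (K := ℚ) ℚ_[p]) W 0, Q = p ^ m • Q' := by
  set ι := closureEmb (K := ℚ) ℚ_[p] with hι
  have htorsn := eq_zero_of_prime_smul_eq_zero_localLayerPointsOfEmb W K₀ hθ hc κ hCV η hη hp2 M htr hVM hU n
  induction m with
  | zero => exact fun {Q} _ _ hQ _ _ _ => ⟨Q, hQ, by rw [pow_zero, one_smul]⟩
  | succ m ih =>
    intro Q x D hQ hx hDn hQxD
    -- one step with `p^m • D` in place of `D`
    have hQ' : Q = x - p • (p ^ m • D) := by rw [hQxD, ← mul_smul, ← pow_succ']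
    obtain ⟨Q₁, hQ₁, hQQ₁⟩ := exists_eq_smul_of_eq_zeroClause_sub_smul W K₀ hθ hc κ hCV η hη hD hκ₀ hidx
      hp2 M htr hVM hU hQ hx ((localLayerPointsOfEmb κ ι W n).nsmul_mem hDn _) hQ'
    -- `x = p • (Q₁ + p^m D)` with `Q₁ + p^m D ∈ W_n`, so `x₁ := Q₁ + p^m D ∈ N_n` (saturation)
    have hx₁W : Q₁ + p ^ m • D ∈ localLayerPointsOfEmb κ ι W n :=
      (localLayerPointsOfEmb κ ι W n).add_mem (localLayerPointsOfEmb_mono κ ι W (Nat.zero_le n) hQ₁)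
        ((localLayerPointsOfEmb κ ι W n).nsmul_mem hDn _)
    have hpx₁ : p ^ 1 • (Q₁ + p ^ m • D) = x := by
      rw [pow_one, smul_add]
      have : p • Q₁ = x - p • (p ^ m • D) := by rw [← hQQ₁, hQ']
      rw [this, sub_add_cancel]
    have hx₁ : Q₁ + p ^ m • D ∈ signedLocalPointsOfEmb κ ι W (-1) n ⊓ (localTraceOfEmb κ ι W 0 n).ker :=
      mem_zeroClause_of_pow_smul_mem κ ι W n 1 htorsn hx₁W (hpx₁ ▸ hx)
    -- induction
    obtain ⟨Q', hQ'0, hQ₁Q'⟩ := ih hQ₁ hx₁ hDn (by rw [add_sub_cancel_right])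
    exact ⟨Q', hQ'0, by rw [hQQ₁, hQ₁Q', ← mul_smul, ← pow_succ']⟩

/-! ## §2 Transversality in `H¹(ℚ_p, W[p^m])` -/

include hθ hc hCV hη in
/-- **TRANSVERSALITY (B3, cocycle currency).** A class `ξ ∈ H¹(ℚ_p, W[p^m])` which (a) restricts on
`Gal(ℚ̄_p/ℚ_n·ℚ_p)` to the Kummer cocycle `u ↦ uR − R` of a `p^m`-th root `R` of a zero-clause
minus point `x ∈ N_n`, and (b) is the Kummer class of a point `Q ∈ W(ℚ_p)` (represented by
`u ↦ uR′ − R′` on `Γ_{ℚ_p}` with `p^m R′ = Q`), VANISHES: `Σ_m ∩ 𝓚 = 0` for any receptacle `Σ_m`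
of classes with (a). [cite: Kobayashi2003, Thm. 6.2 (p. 11), Prop. 8.12 ii) (pp. 17–18),
Lemma 8.17 (p. 19), Prop. 8.7 (p. 16)] [cite: GreenbergLNM1716, §3 p. 86] -/
theorem eq_zero_of_minus_of_kummer
    (hD : ∀ g : absoluteGaloisGroup ℚ, ∃ τ : absoluteGaloisGroup ℚ_[p],
      (resGalOfEmb (closureEmb (K := ℚ) ℚ_[p]) τ)⁻¹ * g ∈ towerTopSubgroup κ K₀)
    (hκ₀ : ∀ x, ∃ g ∈ galRange (K := ℚ) K₀, κ g = x) [(galRange (K := ℚ) K₀).Normal]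
    (hidx : (galRange (K := ℚ) K₀).index ≤ p - 1) (hp2 : p ≠ 2)
    (M : WeierstrassCurve ℤ_[p]) [hE : (M.map PadicInt.Coe.ringHom).IsElliptic]
    [hEt : (M.map PadicInt.toZMod).IsElliptic]
    (htr : Literature.NumberTheory.EllipticCurves.HasseManin.tr (M.map PadicInt.toZMod) = 0)
    (hVM : M.baseChange (AlgebraicClosure ℚ_[p]) = V.baseChange (AlgebraicClosure ℚ_[p]))
    (hU : ∀ n, localSubgroupOfEmb (towerSubgroup κ K₀ n) (closureEmb (K := ℚ) ℚ_[p]) = stab p (n + 1))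
    {n m : ℕ}
    {ξ : galoisCohomology (GaloisRep.restrictField ℚ_[p] (W.torsionGaloisModule ((p ^ m : ℕ) : ℤ))) 1}
    (hminus : ∃ x ∈ signedLocalPointsOfEmb κ (closureEmb (K := ℚ) ℚ_[p]) W (-1) n ⊓
          (localTraceOfEmb κ (closureEmb (K := ℚ) ℚ_[p]) W 0 n).ker,
        ∃ R : localPoints W ℚ_[p], ((p ^ m : ℕ) : ℤ) • R = x ∧
        ∃ φ : contOneCocycles (DiscreteGaloisModule.toTopRep
            (GaloisRep.restrictField ℚ_[p] (W.torsionGaloisModule ((p ^ m : ℕ) : ℤ)))),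
          oneCocycleClass _ φ = ξ ∧
          ∀ u ∈ localLayerSubgroupOfEmb κ (closureEmb (K := ℚ) ℚ_[p]) n,
            pointsMap W ℚ_[p] ((φ.1 u : geomTorsion W ((p ^ m : ℕ) : ℤ)) : geomPoints W) = u • R - R)
    (hkummer : ∃ Q ∈ localLayerPointsOfEmb κ (closureEmb (K := ℚ) ℚ_[p]) W 0,
        ∃ R' : localPoints W ℚ_[p], ((p ^ m : ℕ) : ℤ) • R' = Q ∧
        ∃ φ' : contOneCocycles (DiscreteGaloisModule.toTopRep
            (GaloisRep.restrictField ℚ_[p] (W.torsionGaloisModule ((p ^ m : ℕ) : ℤ)))),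
          oneCocycleClass _ φ' = ξ ∧
          ∀ u : absoluteGaloisGroup ℚ_[p],
            pointsMap W ℚ_[p] ((φ'.1 u : geomTorsion W ((p ^ m : ℕ) : ℤ)) : geomPoints W) = u • R' - R') :
    ξ = 0 := by
  set ι := closureEmb (K := ℚ) ℚ_[p] with hι
  set nn : ℤ := ((p ^ m : ℕ) : ℤ) with hnn
  have hnn0 : nn ≠ 0 := by rw [hnn]; exact_mod_cast pow_ne_zero m hp.out.ne_zero
  obtain ⟨x, hx, R, hR, φ, hφξ, hφ⟩ := hminus
  obtain ⟨Q, hQ, R', hR', φ', hφ'ξ, hφ'⟩ := hkummer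
  -- compare the two cocycles: `φ − φ'` is the coboundary of a torsion point `T`
  have h0 : oneCocycleClass _ (φ - φ') = 0 := by rw [oneCocycleClass_sub, hφξ, hφ'ξ, sub_self]
  obtain ⟨v, hv⟩ := (oneCocycleClass_eq_zero_iff _ _).mp h0
  set T : localPoints W ℚ_[p] := pointsMap W ℚ_[p] ((v : geomTorsion W nn) : geomPoints W) with hT
  have hTtor : nn • T = 0 := by
    rw [hT, ← map_zsmul]
    have : nn • ((v : geomTorsion W nn) : geomPoints W) = 0 := v.2
    rw [this, map_zero]
  -- `D := R − R' − T ∈ W_n`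
  have hfix : ∀ u ∈ localLayerSubgroupOfEmb κ ι n, u • (R - R' - T) = R - R' - T := by
    intro u hu
    have h1 := congrArg (fun z : geomTorsion W nn => pointsMap W ℚ_[p] (z : geomPoints W)) (hv u)
    simp only at h1
    have hl : pointsMap W ℚ_[p] (((φ - φ').1 u : geomTorsion W nn) : geomPoints W) =
        (u • R - R) - (u • R' - R') := by
      rw [← hφ u hu, ← hφ' u, ← map_sub]
      rfl
    have hr : pointsMap W ℚ_[p] ((((DiscreteGaloisModule.toTopRep
        (GaloisRep.restrictField ℚ_[p] (W.torsionGaloisModule nn))).ρ u v - v : geomTorsion W nn)) :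
          geomPoints W) = u • T - T := by
      change pointsMap W ℚ_[p] (((absGaloisRestrict ℚ ℚ_[p] u • v - v : geomTorsion W nn)) : geomPoints W) = _
      rw [← resGal_eq_absGaloisRestrict, AddSubgroup.coe_sub, map_sub, hT]
      congr 1
      exact pointsMap_smul W ℚ_[p] u _
    rw [hl, hr] at h1
    rw [smul_sub, smul_sub]
    linear_combination (norm := abel_nf) h1
  have hDn : R - R' - T ∈ localLayerPointsOfEmb κ ι W n := (mem_localLayerPointsOfEmb_iff κ ι W n _).mpr hfix
  -- `Q = x − p^m • (R − R' − T)`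
  have hQxD : Q = x - p ^ m • (R - R' - T) := by
    rw [← natCast_zsmul, ← hnn, zsmul_sub, zsmul_sub, hR, hR', hTtor, sub_zero, sub_sub_cancel]
  -- so `Q = p^m • Q_m` with `Q_m ∈ W(ℚ_p)`
  obtain ⟨Qm, hQm, hQQm⟩ := exists_eq_pow_smul_of_eq_zeroClause_sub_pow_smul W K₀ hθ hc κ hCV η hη hD hκ₀
    hidx hp2 M htr hVM hU m hQ hx hDn hQxD
  -- `φ'` is the coboundary of the torsion point `R' − Q_m`
  have htor : R' - Qm ∈ AddSubgroup.torsionBy (localPoints W ℚ_[p]) nn := by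
    change nn • (R' - Qm) = 0
    rw [zsmul_sub, hR', hQQm, hnn, natCast_zsmul, sub_self]
  set v₀ : geomTorsion W nn := (W.torsionPointsEquiv nn (E := ℚ_[p]) hnn0).symm ⟨R' - Qm, htor⟩ with hv₀
  have hv₀T : pointsMap W ℚ_[p] ((v₀ : geomTorsion W nn) : geomPoints W) = R' - Qm :=
    W.pointsMap_torsionPointsEquiv_symm nn hnn0 _
  have hQmfix : ∀ u : absoluteGaloisGroup ℚ_[p], u • Qm = Qm :=
    (mem_localLayerPointsOfEmb_zero_iff κ ι W Qm).mp hQm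
  have hcob : oneCocycleClass _ φ' = 0 := by
    refine (oneCocycleClass_eq_zero_iff _ _).mpr ⟨v₀, fun u => ?_⟩
    apply Subtype.ext
    apply pointsMapOfEmb_injective W (closureEmb (K := ℚ) ℚ_[p])
    change pointsMap W ℚ_[p] ((φ'.1 u : geomTorsion W nn) : geomPoints W) =
      pointsMap W ℚ_[p] ((((DiscreteGaloisModule.toTopRep
        (GaloisRep.restrictField ℚ_[p] (W.torsionGaloisModule nn))).ρ u v₀ - v₀ : geomTorsion W nn)) :
          geomPoints W)
    have hr : pointsMap W ℚ_[p] ((((DiscreteGaloisModule.toTopRep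
        (GaloisRep.restrictField ℚ_[p] (W.torsionGaloisModule nn))).ρ u v₀ - v₀ : geomTorsion W nn)) :
          geomPoints W) = u • (R' - Qm) - (R' - Qm) := by
      change pointsMap W ℚ_[p] (((absGaloisRestrict ℚ ℚ_[p] u • v₀ - v₀ : geomTorsion W nn)) : geomPoints W) = _
      rw [← resGal_eq_absGaloisRestrict, AddSubgroup.coe_sub, map_sub, hv₀T]
      congr 1
      rw [← hv₀T]
      exact pointsMap_smul W ℚ_[p] u _
    rw [hr, hφ' u, smul_sub, hQmfix u]
    abel
  rw [← hφ'ξ]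
  exact hcob

end Generic

/-! ## §3 Kobayashi's setting -/

section Cyclotomic

variable (W : WeierstrassCurve ℚ) [W.IsElliptic] {p : ℕ} [hp : Fact p.Prime] (κ : ZpExtension ℚ p)
  {V : WeierstrassCurve ℚ} [V.IsElliptic]
  (F : Type) [Field F] [NumberField F] [IsCyclotomicExtension {p} ℚ F]

include F in
/-- **Transversality of the minus Kummer classes to the Kummer image of `W(ℚ_p)`, Kobayashi's
setting** (`F` a `p`-th cyclotomic field, `κ` cyclotomic, `V = C • W^{(p*)}` with a good supersingular
`a_p = 0` model, `p` odd): a class of `H¹(ℚ_p, W[p^m])` satisfying (a) and (b) of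
`eq_zero_of_minus_of_kummer` is zero. [cite: Kobayashi2003, §3 p. 5, Thm. 6.2 (p. 11),
Prop. 8.12 ii) (pp. 17–18), Lemma 8.17 (p. 19)] -/
theorem eq_zero_of_minus_of_kummer_cyclotomic (hp2 : p ≠ 2) (hκ : κ.IsCyclotomic)
    (C : VariableChange ℚ) (hCV : C • W.quadraticTwist ((-1) ^ (p / 2) * p) = V)
    (M : WeierstrassCurve ℤ_[p]) [hE : (M.map PadicInt.Coe.ringHom).IsElliptic]
    [hEt : (M.map PadicInt.toZMod).IsElliptic]
    (htr : Literature.NumberTheory.EllipticCurves.HasseManin.tr (M.map PadicInt.toZMod) = 0)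
    (hVM : M.baseChange (AlgebraicClosure ℚ_[p]) = V.baseChange (AlgebraicClosure ℚ_[p]))
    {n m : ℕ}
    {ξ : galoisCohomology (GaloisRep.restrictField ℚ_[p] (W.torsionGaloisModule ((p ^ m : ℕ) : ℤ))) 1}
    (hminus : ∃ x ∈ signedLocalPointsOfEmb κ (closureEmb (K := ℚ) ℚ_[p]) W (-1) n ⊓
          (localTraceOfEmb κ (closureEmb (K := ℚ) ℚ_[p]) W 0 n).ker,
        ∃ R : localPoints W ℚ_[p], ((p ^ m : ℕ) : ℤ) • R = x ∧
        ∃ φ : contOneCocycles (DiscreteGaloisModule.toTopRep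
            (GaloisRep.restrictField ℚ_[p] (W.torsionGaloisModule ((p ^ m : ℕ) : ℤ)))),
          oneCocycleClass _ φ = ξ ∧
          ∀ u ∈ localLayerSubgroupOfEmb κ (closureEmb (K := ℚ) ℚ_[p]) n,
            pointsMap W ℚ_[p] ((φ.1 u : geomTorsion W ((p ^ m : ℕ) : ℤ)) : geomPoints W) = u • R - R)
    (hkummer : ∃ Q ∈ localLayerPointsOfEmb κ (closureEmb (K := ℚ) ℚ_[p]) W 0,
        ∃ R' : localPoints W ℚ_[p], ((p ^ m : ℕ) : ℤ) • R' = Q ∧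
        ∃ φ' : contOneCocycles (DiscreteGaloisModule.toTopRep
            (GaloisRep.restrictField ℚ_[p] (W.torsionGaloisModule ((p ^ m : ℕ) : ℤ)))),
          oneCocycleClass _ φ' = ξ ∧
          ∀ u : absoluteGaloisGroup ℚ_[p],
            pointsMap W ℚ_[p] ((φ'.1 u : geomTorsion W ((p ^ m : ℕ) : ℤ)) : geomPoints W) = u • R' - R') :
    ξ = 0 := by
  obtain ⟨θ, hθ2⟩ := exists_sq_eq_pStar p F hp2
  have hc : θ ^ 2 = algebraMap ℚ F ((-1) ^ (p / 2) * p) := by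
    rw [hθ2, map_mul, map_pow, map_neg, map_one, map_natCast]
  have hθ : θ ∉ Set.range (algebraMap ℚ F) := by
    rintro ⟨q, hq⟩
    apply sq_ne_neg_one_pow_mul_prime hp.out (p / 2) q
    apply (algebraMap ℚ F).injective
    rw [map_pow, hq, hc]
  obtain ⟨η, hη⟩ := exists_eta_iff_smul_rootInClosure F hθ hc
  haveI := normal_galRange_cyclotomic p F
  exact eq_zero_of_minus_of_kummer W F hθ hc κ hCV η hη (localTowerHyp_padic p κ F hκ)
    (kappa_surjOn_galRange_cyclotomic κ F) (index_galRange_cyclotomic p F).le hp2 M htr hVM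
    (localSubgroupOfEmb_towerSubgroup_eq_stab_rat F (closureEmb (K := ℚ) ℚ_[p]) κ hp2 hκ) hminus hkummer

end Cyclotomic

end Summit.BirchSwinnertonDyer.Rank1Residual.Additive.SignedTwist

end
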